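import Summits.QuantumFields.BalabanUV.T4Continuum.Support.ShellMeasureHistoriesTransportIterate

/-!
# `T4Continuum.ShellMeasureHistoriesTransportKept` — THE SLOT'S OWN SMALL-FIELD INDICATOR PASSES THROUGH THE TRANSPORT: a factor
# read off the LAYER variable factors out of the kernel transport (a.e.), so a history's law with its own indicator KEPT images to
# the KEPT layer measure `(ν m).withDensity ({y | u' y < θ}.indicator F)` — the measure in the conclusion of the kept END export
(cell `pub-balaban`, sub-cell `t4`, spine estimate NE7c (node U5b); NE7c ROUND-2 crew, unit `b2b-balaban-t4-ne7c-formalise-leaf-03`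
gen 8 («the measure side», R-ne7cp1-g35-6 (a)); OFFER journal l.21313 (INFO-2 of my XREADs C-ne7cleaf03g8-3∕-4 of row S103a);
ADDITIVE — imports S103a f2 `ShellMeasureHistoriesTransportIterate` (leaf-08-g16; hence f1 `ShellMeasureHistoriesTransport` and the
cell's `T4AveragingDisintegration`) ONLY; [folklore] measure theory; 0 `def`, 0 `def … : Prop`, 0 sorry, 0 citation tags)

HONEST FRAMING.  Finite four-torus programme, rung (B)+1 only — NOT infinite volume, NOT a mass gap, NOT the Clay problem, NOT
summit progress; NE7c (`T4IndicatorShell.ShellWeightBound`) NOT PRINTED, NOT PROVED; «NE7c ⇐ the named binders» (c3).  STRUCTURAL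
BOOKKEEPING on OUR side (disintegration algebra); nothing of Bałaban's is touched, asserted or discharged; NOTHING in the countdown
moves.  HONEST DEPENDENCY (cell): continuum YM on T⁴ ⇐ BetaPertH ∧ nine spine estimates (0/9 proved); BetaPertH ⇐ (D1) ∧ (D4) ∧
CAP+tail; G-an2-4 gates asym, D1 and NE2/3/4.

THE POINT (row S103b's junction between the KEPT END `ShellMeasureLandauEndAssembledDecayReachBoxKept.…_of_core_collar_kept` and
the transport S103a).  A history's law is `histLaw ν sm u ϑ = ν.withDensity (∏_{s'∈sm} χ_{ϑ s'}(u s'))` with the slot's OWN factor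
`χ_{ϑ s}(u s)` among them (S24, «own indicator kept»), and the slot variable is READ OFF THE LAYER, `u s = u' ∘ π` (S103a §2).
A factor of the form `g ∘ avg` commutes with the one-step kernel transport — `T((g ∘ avg)·f) = g · T f` `μ`-a.e. — so the own
indicator arrives on the layer AS AN INDICATOR of `{u' < θ}`: the layer measure is `(ν m).withDensity ({y | u' y < θ}.indicator F')`,
EXACTLY the measure about which the kept END concludes (M1).  No large-field estimate, no dropped-indicator weakening anywhere.
* §1 `integrable_comp_mul`, **`kernelTransport_comp_mul_ae`** — `kernelTransport ν μ avg ((g ∘ avg)·f) =ᵐ[μ] g · kernelTransport ν μ avg f`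
  for bounded measurable `g`, integrable `f` (a.e. uniqueness `ae_eq_of_forall_integral_mul_eq` + the push-forward identity
  `integral_kernelTransport_mul` twice).
* §2 **`map_withDensity_comp_mul`** (measure form at one step) and **`map_withDensity_indicator_mul`** (the indicator case:
  `(ν.withDensity (ofReal ∘ 𝟙{u'∘avg < θ}·f)).map avg = μ.withDensity ({V | u' V < θ}.indicator (ofReal ∘ T f))`);
  **`slotAntiConcentration_kept_of_oneStep`** — (M1) for the KEPT layer measure along `u'` ⟹ (M1) for the kept fine law along `u' ∘ avg`.
* §3 the FINITE TOWER (S103a f2's data + the factor read on layer `k` through the remaining composite `σ k : β k → β m`,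
  `σ m = id`, `σ k = σ (k+1) ∘ avg k`): `comp_eq_of_tower` (`σ k ∘ π k = σ 0`, hence `σ 0 = π m`), **`map_withDensity_tower_comp_mul`**,
  **`map_withDensity_tower_indicator`**, **`slotAntiConcentration_kept_of_tower`** — the kept END's (M1) on ANY layer `m ≤ M` gives
  (M1) for the finest law tilted by `𝟙{u'∘π m < θ} · ρ 0` along `u' ∘ π m`, SAME `θ ρ' D`.
NOT HERE: the instantiation (Bałaban's averaging tower, the history's density) — S103b's; no END is re-fired.
-/

noncomputable section

open MeasureTheory Set

namespace Summit.QuantumFields.BalabanUV.T4Continuum.ShellMeasureHistoriesTransportKept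

open scoped ENNReal
open Literature.MathematicalPhysics.QuantumFieldTheory.Balaban1983to89
open T4ShellMeasure (SlotAntiConcentration)
open T4AveragingDisintegration (kernelTransport kernelTransport_nonneg integrable_kernelTransport integral_kernelTransport_mul
  ae_eq_of_forall_integral_mul_eq)
open ShellMeasureHistoriesTransport (map_withDensity_eq_withDensity_kernelTransport slotAntiConcentration_of_layer)
open ShellMeasureHistoriesTransportIterate (map_withDensity_tower)

/-! ## §1 A factor read off the image commutes with the kernel transport (a.e.) -/

section OneStep

variable {α β : Type*} [MeasurableSpace α] [MeasurableSpace β] [StandardBorelSpace β] [Nonempty β]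

omit [StandardBorelSpace β] [Nonempty β] in
/-- `(g ∘ avg) · f` is integrable for bounded measurable `g` and integrable `f`. [folklore] -/
theorem integrable_comp_mul (ν : Measure β) {avg : β → α} (havg : Measurable avg) {f : β → ℝ} (hf : Integrable f ν)
    {g : α → ℝ} (hg : Measurable g) {C : ℝ} (hC : ∀ V, |g V| ≤ C) : Integrable (fun U => g (avg U) * f U) ν := by
  have h := hf.mul_bdd (hg.comp havg).aestronglyMeasurable
    (Filter.Eventually.of_forall fun U => by simpa [Real.norm_eq_abs] using hC (avg U))
  exact h.congr (ae_of_all _ fun U => by simp only [Function.comp]; ring)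

/-- **THE OWN FACTOR COMMUTES WITH THE TRANSPORT (a.e.)**: for bounded measurable `g` on the image and `ν`-integrable `f`,
`kernelTransport ν μ avg ((g ∘ avg)·f) = g · kernelTransport ν μ avg f` `μ`-almost everywhere — a.e. uniqueness of densities
(`ae_eq_of_forall_integral_mul_eq`) after testing both sides with `integral_kernelTransport_mul`:
`∫ T((g∘avg)f)·φ dμ = ∫ (g∘avg)·f·(φ∘avg) dν = ∫ f·((g·φ)∘avg) dν = ∫ Tf·(g·φ) dμ`. [folklore] -/
theorem kernelTransport_comp_mul_ae (ν : Measure β) [IsFiniteMeasure ν] (μ : Measure α) [SigmaFinite μ] {avg : β → α}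
    (havg : Measurable avg) (hac : ν.map avg ≪ μ) {f : β → ℝ} (hf : Integrable f ν) {g : α → ℝ} (hg : Measurable g)
    {C : ℝ} (hC : ∀ V, |g V| ≤ C) :
    kernelTransport ν μ avg (fun U => g (avg U) * f U) =ᵐ[μ] fun V => g V * kernelTransport ν μ avg f V := by
  have hgf := integrable_comp_mul ν havg hf hg hC
  have h1 : Integrable (kernelTransport ν μ avg (fun U => g (avg U) * f U)) μ := integrable_kernelTransport ν μ havg hac hgf
  have hT : Integrable (kernelTransport ν μ avg f) μ := integrable_kernelTransport ν μ havg hac hf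
  have h2 : Integrable (fun V => g V * kernelTransport ν μ avg f V) μ := by
    have h := hT.mul_bdd hg.aestronglyMeasurable (Filter.Eventually.of_forall fun V => by simpa [Real.norm_eq_abs] using hC V)
    exact h.congr (ae_of_all _ fun V => by ring)
  refine ae_eq_of_forall_integral_mul_eq h1 h2 fun φ hφ hφb => ?_
  obtain ⟨Cφ, hCφ⟩ := hφb
  have hgφ : Measurable fun V => g V * φ V := hg.mul hφ
  have hb : ∀ V, |g V * φ V| ≤ C * Cφ := fun V => by
    rw [abs_mul]; exact mul_le_mul (hC V) (hCφ V) (abs_nonneg _) ((abs_nonneg _).trans (hC V))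
  rw [integral_kernelTransport_mul ν μ havg hac hgf hφ hCφ]
  have key := integral_kernelTransport_mul ν μ havg hac hf hgφ hb
  symm
  calc ∫ V, g V * kernelTransport ν μ avg f V * φ V ∂μ
      = ∫ V, kernelTransport ν μ avg f V * (g V * φ V) ∂μ := by congr 1; funext V; ring
    _ = ∫ U, f U * (g (avg U) * φ (avg U)) ∂ν := key
    _ = ∫ U, g (avg U) * f U * φ (avg U) ∂ν := by congr 1; funext U; ring

/-! ## §2 The measure form at one step; the indicator case; (M1) junction -/

/-- **THE IMAGE OF A FINE LAW TILTED BY `(g ∘ avg)·f` IS THE COARSE REFERENCE TILTED BY `g · T f`** (`g ≥ 0` bounded measurable,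
`f ≥ 0` integrable; S103a §4 + §1). [folklore] -/
theorem map_withDensity_comp_mul (ν : Measure β) [IsFiniteMeasure ν] (μ : Measure α) [SigmaFinite μ] {avg : β → α}
    (havg : Measurable avg) (hac : ν.map avg ≪ μ) {f : β → ℝ} (hf : Integrable f ν) (hf0 : ∀ U, 0 ≤ f U) {g : α → ℝ}
    (hg : Measurable g) (hg0 : ∀ V, 0 ≤ g V) {C : ℝ} (hC : ∀ V, |g V| ≤ C) :
    (ν.withDensity fun U => ENNReal.ofReal (g (avg U) * f U)).map avg =
      μ.withDensity fun V => ENNReal.ofReal (g V) * ENNReal.ofReal (kernelTransport ν μ avg f V) := by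
  rw [map_withDensity_eq_withDensity_kernelTransport ν μ havg hac (integrable_comp_mul ν havg hf hg hC)
    (fun U => mul_nonneg (hg0 _) (hf0 U))]
  refine withDensity_congr_ae ?_
  filter_upwards [kernelTransport_comp_mul_ae ν μ havg hac hf hg hC] with V hV
  rw [hV, ENNReal.ofReal_mul (hg0 V)]

/-- **THE INDICATOR CASE**: a fine law tilted by `𝟙{u' ∘ avg < θ} · f` images to the coarse reference tilted by the INDICATOR-
RESTRICTED transported density `{V | u' V < θ}.indicator (ofReal ∘ T f)` — the measure of the KEPT END's conclusion. [folklore] -/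
theorem map_withDensity_indicator_mul (ν : Measure β) [IsFiniteMeasure ν] (μ : Measure α) [SigmaFinite μ] {avg : β → α}
    (havg : Measurable avg) (hac : ν.map avg ≪ μ) {f : β → ℝ} (hf : Integrable f ν) (hf0 : ∀ U, 0 ≤ f U) {u' : α → ℝ}
    (hu' : Measurable u') (θ : ℝ) :
    (ν.withDensity fun U => ENNReal.ofReal ({U | u' (avg U) < θ}.indicator f U)).map avg =
      μ.withDensity ({V | u' V < θ}.indicator fun V => ENNReal.ofReal (kernelTransport ν μ avg f V)) := by
  have hS : MeasurableSet {V | u' V < θ} := hu' measurableSet_Iio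
  have hgm : Measurable ({V | u' V < θ}.indicator fun _ => (1 : ℝ)) := measurable_const.indicator hS
  have hg0 : ∀ V, 0 ≤ {V | u' V < θ}.indicator (fun _ => (1 : ℝ)) V := fun V => by
    by_cases hV : V ∈ {V | u' V < θ} <;> simp [hV]
  have hgC : ∀ V, |{V | u' V < θ}.indicator (fun _ => (1 : ℝ)) V| ≤ 1 := fun V => by
    by_cases hV : V ∈ {V | u' V < θ} <;> simp [hV]
  have e1 : (fun U => ENNReal.ofReal ({U | u' (avg U) < θ}.indicator f U)) =
      fun U => ENNReal.ofReal ({V | u' V < θ}.indicator (fun _ => (1 : ℝ)) (avg U) * f U) := by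
    funext U
    by_cases hU : u' (avg U) < θ
    · rw [indicator_of_mem (show U ∈ {U | u' (avg U) < θ} from hU),
        indicator_of_mem (show avg U ∈ {V | u' V < θ} from hU), one_mul]
    · rw [indicator_of_notMem (show U ∉ {U | u' (avg U) < θ} from hU),
        indicator_of_notMem (show avg U ∉ {V | u' V < θ} from hU), zero_mul]
  have e2 : ({V | u' V < θ}.indicator fun V => ENNReal.ofReal (kernelTransport ν μ avg f V)) =
      fun V => ENNReal.ofReal ({V | u' V < θ}.indicator (fun _ => (1 : ℝ)) V) *
        ENNReal.ofReal (kernelTransport ν μ avg f V) := by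
    funext V
    by_cases hV : V ∈ {V | u' V < θ}
    · rw [indicator_of_mem hV, indicator_of_mem hV, ENNReal.ofReal_one, one_mul]
    · rw [indicator_of_notMem hV, indicator_of_notMem hV, ENNReal.ofReal_zero, zero_mul]
  rw [e1, e2]
  exact map_withDensity_comp_mul ν μ havg hac hf hf0 hgm hg0 hgC

/-- **(M1) KEPT, THROUGH ONE AVERAGING STEP**: if the KEPT layer measure `μ.withDensity ({u' < θ}.indicator (ofReal ∘ T f))`
satisfies (M1) along `u'` at `θ` (the kept END export's conclusion shape), then the kept fine law
`ν.withDensity (ofReal ∘ (𝟙{u'∘avg < θ}·f))` satisfies (M1) along `u' ∘ avg` at `θ`, SAME `ρ' D`. [folklore] -/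
theorem slotAntiConcentration_kept_of_oneStep (ν : Measure β) [IsFiniteMeasure ν] (μ : Measure α) [SigmaFinite μ]
    {avg : β → α} (havg : Measurable avg) (hac : ν.map avg ≪ μ) {f : β → ℝ} (hf : Integrable f ν) (hf0 : ∀ U, 0 ≤ f U)
    {u' : α → ℝ} (hu' : Measurable u') {θ ρ' D : ℝ}
    (h : SlotAntiConcentration (μ.withDensity ({V | u' V < θ}.indicator fun V => ENNReal.ofReal (kernelTransport ν μ avg f V)))
      u' θ ρ' D) :
    SlotAntiConcentration (ν.withDensity fun U => ENNReal.ofReal ({U | u' (avg U) < θ}.indicator f U)) (u' ∘ avg) θ ρ' D :=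
  slotAntiConcentration_of_layer havg rfl (map_withDensity_indicator_mul ν μ havg hac hf hf0 hu' θ) h

end OneStep

/-! ## §3 The finite tower: the own factor read on every layer through the remaining composite -/

section Tower

variable {β : ℕ → Type*} [∀ m, MeasurableSpace (β m)] [∀ m, StandardBorelSpace (β m)] [∀ m, Nonempty (β m)]

omit [∀ m, MeasurableSpace (β m)] [∀ m, StandardBorelSpace (β m)] [∀ m, Nonempty (β m)] in
/-- the remaining composites are consistent with the iterated maps: `σ k ∘ π k = σ 0` for `k ≤ m`; in particular `π m = σ 0`.
[folklore] -/
theorem comp_eq_of_tower (avg : ∀ m, β m → β (m + 1)) {M : ℕ} (π : ∀ m, β 0 → β m) (hπ0 : π 0 = id)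
    (hπs : ∀ m < M, π (m + 1) = avg m ∘ π m) {m : ℕ} (hm : m ≤ M) (σ : ∀ k, β k → β m) (hσm : σ m = id)
    (hσs : ∀ k < m, σ k = σ (k + 1) ∘ avg k) : (∀ k ≤ m, σ k ∘ π k = σ 0) ∧ π m = σ 0 := by
  have H : ∀ k ≤ m, σ k ∘ π k = σ 0 := by
    intro k hk
    induction k with
    | zero => rw [hπ0]; rfl
    | succ k ih =>
      rw [hπs k (by omega), ← Function.comp_assoc, ← hσs k (by omega)]
      exact ih (by omega)
  refine ⟨H, ?_⟩
  have := H m le_rfl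
  rwa [hσm, Function.id_comp] at this

/-- **THE TOWER FORM OF §2**: with S103a f2's finite-tower data and a bounded measurable nonnegative factor `g` on layer `m ≤ M`
read on layer `k` through the remaining composite `σ k` (`σ m = id`, `σ k = σ (k+1) ∘ avg k`, measurable), the finest law tilted
by `(g ∘ σ 0) · ρ 0` images under `π m` to `(ν m).withDensity (ofReal ∘ g · ofReal ∘ ρ m)`. [folklore] -/
theorem map_withDensity_tower_comp_mul (ν : ∀ m, Measure (β m)) [∀ m, IsFiniteMeasure (ν m)]
    (avg : ∀ m, β m → β (m + 1)) {M : ℕ} (havg : ∀ m < M, Measurable (avg m))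
    (hac : ∀ m < M, (ν m).map (avg m) ≪ ν (m + 1)) (π : ∀ m, β 0 → β m) (hπ0 : π 0 = id)
    (hπs : ∀ m < M, π (m + 1) = avg m ∘ π m) (ρ : ∀ m, β m → ℝ)
    (hρs : ∀ m < M, ρ (m + 1) = kernelTransport (ν m) (ν (m + 1)) (avg m) (ρ m)) (hρ0i : Integrable (ρ 0) (ν 0))
    (hρ00 : ∀ x, 0 ≤ ρ 0 x) {m : ℕ} (hm : m ≤ M) (σ : ∀ k, β k → β m) (hσm : σ m = id)
    (hσs : ∀ k < m, σ k = σ (k + 1) ∘ avg k) (hσ : ∀ k ≤ m, Measurable (σ k)) {g : β m → ℝ} (hg : Measurable g)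
    (hg0 : ∀ y, 0 ≤ g y) {C : ℝ} (hC : ∀ y, |g y| ≤ C) :
    ((ν 0).withDensity fun x => ENNReal.ofReal (g (σ 0 x) * ρ 0 x)).map (π m) =
      (ν m).withDensity fun y => ENNReal.ofReal (g y) * ENNReal.ofReal (ρ m y) := by
  suffices H : ∀ k ≤ m, ((ν 0).withDensity fun x => ENNReal.ofReal (g (σ 0 x) * ρ 0 x)).map (π k) =
      (ν k).withDensity fun y => ENNReal.ofReal (g (σ k y)) * ENNReal.ofReal (ρ k y) by
    have h := H m le_rfl
    rw [hσm] at h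
    exact h
  intro k hk
  induction k with
  | zero =>
    rw [hπ0, Measure.map_id]
    congr 1
    funext x
    rw [ENNReal.ofReal_mul (hg0 _)]
  | succ k ih =>
    have hk' : k < m := by omega
    have hkM : k < M := by omega
    obtain ⟨h0, hi, hπk, -⟩ := map_withDensity_tower ν avg havg hac π hπ0 hπs ρ hρs hρ0i hρ00 k (by omega)
    rw [hπs k hkM, ← Measure.map_map (havg k hkM) hπk, ih hk'.le]
    have e : (fun y => ENNReal.ofReal (g (σ k y)) * ENNReal.ofReal (ρ k y)) =
        fun y => ENNReal.ofReal ((g ∘ σ (k + 1)) (avg k y) * ρ k y) := by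
      funext y
      rw [hσs k hk', ← ENNReal.ofReal_mul (hg0 _)]
      rfl
    rw [e, map_withDensity_comp_mul (ν k) (ν (k + 1)) (havg k hkM) (hac k hkM) hi h0 (hg.comp (hσ (k + 1) (by omega)))
      (fun z => hg0 _) (fun z => hC _), hρs k hkM]
    rfl

/-- **THE TOWER, INDICATOR CASE**: the finest law tilted by `𝟙{u' ∘ π m < θ} · ρ 0` images under `π m` to the KEPT layer measure
`(ν m).withDensity ({y | u' y < θ}.indicator (ofReal ∘ ρ m))`. [folklore] -/
theorem map_withDensity_tower_indicator (ν : ∀ m, Measure (β m)) [∀ m, IsFiniteMeasure (ν m)]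
    (avg : ∀ m, β m → β (m + 1)) {M : ℕ} (havg : ∀ m < M, Measurable (avg m))
    (hac : ∀ m < M, (ν m).map (avg m) ≪ ν (m + 1)) (π : ∀ m, β 0 → β m) (hπ0 : π 0 = id)
    (hπs : ∀ m < M, π (m + 1) = avg m ∘ π m) (ρ : ∀ m, β m → ℝ)
    (hρs : ∀ m < M, ρ (m + 1) = kernelTransport (ν m) (ν (m + 1)) (avg m) (ρ m)) (hρ0i : Integrable (ρ 0) (ν 0))
    (hρ00 : ∀ x, 0 ≤ ρ 0 x) {m : ℕ} (hm : m ≤ M) (σ : ∀ k, β k → β m) (hσm : σ m = id)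
    (hσs : ∀ k < m, σ k = σ (k + 1) ∘ avg k) (hσ : ∀ k ≤ m, Measurable (σ k)) {u' : β m → ℝ} (hu' : Measurable u')
    (θ : ℝ) :
    ((ν 0).withDensity fun x => ENNReal.ofReal ({x | u' (π m x) < θ}.indicator (ρ 0) x)).map (π m) =
      (ν m).withDensity ({y | u' y < θ}.indicator fun y => ENNReal.ofReal (ρ m y)) := by
  have hS : MeasurableSet {y | u' y < θ} := hu' measurableSet_Iio
  have hπσ : π m = σ 0 := (comp_eq_of_tower avg π hπ0 hπs hm σ hσm hσs).2
  have hgm : Measurable ({y | u' y < θ}.indicator fun _ => (1 : ℝ)) := measurable_const.indicator hS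
  have hg0 : ∀ y, 0 ≤ {y | u' y < θ}.indicator (fun _ => (1 : ℝ)) y := fun y => by
    by_cases hy : y ∈ {y | u' y < θ} <;> simp [hy]
  have hgC : ∀ y, |{y | u' y < θ}.indicator (fun _ => (1 : ℝ)) y| ≤ 1 := fun y => by
    by_cases hy : y ∈ {y | u' y < θ} <;> simp [hy]
  have e1 : (fun x => ENNReal.ofReal ({x | u' (π m x) < θ}.indicator (ρ 0) x)) =
      fun x => ENNReal.ofReal ({y | u' y < θ}.indicator (fun _ => (1 : ℝ)) (σ 0 x) * ρ 0 x) := by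
    funext x
    rw [← hπσ]
    by_cases hx : u' (π m x) < θ
    · rw [indicator_of_mem (show x ∈ {x | u' (π m x) < θ} from hx),
        indicator_of_mem (show π m x ∈ {y | u' y < θ} from hx), one_mul]
    · rw [indicator_of_notMem (show x ∉ {x | u' (π m x) < θ} from hx),
        indicator_of_notMem (show π m x ∉ {y | u' y < θ} from hx), zero_mul]
  have e2 : ({y | u' y < θ}.indicator fun y => ENNReal.ofReal (ρ m y)) =
      fun y => ENNReal.ofReal ({y | u' y < θ}.indicator (fun _ => (1 : ℝ)) y) * ENNReal.ofReal (ρ m y) := by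
    funext y
    by_cases hy : y ∈ {y | u' y < θ}
    · rw [indicator_of_mem hy, indicator_of_mem hy, ENNReal.ofReal_one, one_mul]
    · rw [indicator_of_notMem hy, indicator_of_notMem hy, ENNReal.ofReal_zero, zero_mul]
  rw [e1, e2]
  exact map_withDensity_tower_comp_mul ν avg havg hac π hπ0 hπs ρ hρs hρ0i hρ00 hm σ hσm hσs hσ hgm hg0 hgC

/-- **(M1) KEPT, THROUGH THE FINITE TOWER**: the kept END's (M1) on layer `m ≤ M` — for the KEPT layer measure
`(ν m).withDensity ({y | u' y < θ}.indicator (ofReal ∘ ρ m))` along `u'` at `θ` — gives (M1) for the finest law tilted by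
`𝟙{u' ∘ π m < θ} · ρ 0` (the history's density WITH the slot's own indicator) along `u' ∘ π m` at `θ`, SAME `ρ' D`. [folklore] -/
theorem slotAntiConcentration_kept_of_tower (ν : ∀ m, Measure (β m)) [∀ m, IsFiniteMeasure (ν m)]
    (avg : ∀ m, β m → β (m + 1)) {M : ℕ} (havg : ∀ m < M, Measurable (avg m))
    (hac : ∀ m < M, (ν m).map (avg m) ≪ ν (m + 1)) (π : ∀ m, β 0 → β m) (hπ0 : π 0 = id)
    (hπs : ∀ m < M, π (m + 1) = avg m ∘ π m) (ρ : ∀ m, β m → ℝ)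
    (hρs : ∀ m < M, ρ (m + 1) = kernelTransport (ν m) (ν (m + 1)) (avg m) (ρ m)) (hρ0i : Integrable (ρ 0) (ν 0))
    (hρ00 : ∀ x, 0 ≤ ρ 0 x) {m : ℕ} (hm : m ≤ M) (σ : ∀ k, β k → β m) (hσm : σ m = id)
    (hσs : ∀ k < m, σ k = σ (k + 1) ∘ avg k) (hσ : ∀ k ≤ m, Measurable (σ k)) {u' : β m → ℝ} (hu' : Measurable u')
    {θ ρ' D : ℝ}
    (h : SlotAntiConcentration ((ν m).withDensity ({y | u' y < θ}.indicator fun y => ENNReal.ofReal (ρ m y))) u' θ ρ' D) :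
    SlotAntiConcentration ((ν 0).withDensity fun x => ENNReal.ofReal ({x | u' (π m x) < θ}.indicator (ρ 0) x)) (u' ∘ π m)
      θ ρ' D := by
  obtain ⟨-, -, hπm, -⟩ := map_withDensity_tower ν avg havg hac π hπ0 hπs ρ hρs hρ0i hρ00 m hm
  exact slotAntiConcentration_of_layer hπm rfl
    (map_withDensity_tower_indicator ν avg havg hac π hπ0 hπs ρ hρs hρ0i hρ00 hm σ hσm hσs hσ hu' θ) h

end Tower

end Summit.QuantumFields.BalabanUV.T4Continuum.ShellMeasureHistoriesTransportKept

end
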